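import Mathlib.Analysis.Complex.RemovableSingularity
import Mathlib.Analysis.Complex.Liouville
import Literature.Probability.RandomPlanarGeometry.HullApproximation
import Literature.Probability.RandomPlanarGeometry.HullUniformizer
import HarnessLib

/-!
# The Schwarz-reflection extension of `Φ_A` for a `+`-hull ([LSW] §2 and proof of Lemma 3.5)

Proof infrastructure (no new named facts) for [LSW] Lemma 2.1 with the convergence of Lemma 3.5
(`Literature.Probability.RandomPlanarGeometry.IsPlusHull.exists_antitone_isArcHull` of `HullApproximation`), after

* G. F. Lawler, O. Schramm, W. Werner, *Conformal restriction: the chordal case*, J. Amer. Math.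
  Soc. **16** (2003) 917–955, arXiv:math/0209343 (**[LSW]**, arXiv page numbers): proof of
  Lemma 3.5, p. 12 ("the maps may be extended to a neighborhood of `0` by Schwarz reflection in the
  real line") and p. 13 ("Let `A ∈ 𝒬₊`. Set `A' := A ∪ [x₀, x₁]`, where `x₀ := inf (A ∩ ℝ)` and
  `x₁ := sup (A ∩ ℝ)`. … the set of points in `ℍ` with distance at most `δ` from
  `[Φ_A(x₀), Φ_A(x₁)]` … `E_δ` denote the closure of `A ∪ Φ_A⁻¹(D_δ)`").

For a nonempty `A ∈ 𝒬₊` with `x₀ = leftPt A`, `x₁ = rightPt A` (so `realFill A = A ∪ [x₀, x₁]`),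
everything below is PROVED:

* `IsPlusHull.isSlitHull_of_lt` — for every `p ∈ (0, x₀)`, `A` is a one-sided hull with slit `[p, x₁]`
  in the sense of `HullUniformizer`, whose extension `E_p` is an injective holomorphic map of
  `Ω_p = ℂ ∖ (A ∪ Ā ∪ [p, x₁])` restricting to `Φ_A` on `ℍ ∖ A`; `IsPlusHull.baseMap` is the
  restriction map `Φ_A` obtained from `p = x₀/2` (unique: `eqOn_baseMap`).
* `IsPlusHull.extMap` — **the Schwarz reflection `E_A` of `Φ_A`** (boundary extension on `ℍ̄`,
  reflected below), which agrees with every `E_p` on `Ω_p` (`extMap_eq`), hence is injective and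
  holomorphic with non-vanishing derivative on `Ω_A = plusDomain A = ℂ ∖ K_A`,
  `K_A = plusCompact A = A ∪ Ā ∪ [x₀, x₁]` (`K_A ∩ ℍ̄ = realFill A`), maps `ℍ ∖ A` onto `ℍ`,
  commutes with conjugation, is real and strictly increasing on `(-∞, x₀)` and on `(x₁, ∞)`
  (`strictMonoOn_realExt_Iio/Ioi`), with `E_A(z)/z → 1` at `∞`.
* `IsPlusHull.leftVal/rightVal` — the numbers `a = Φ_A(x₀) := sup_{x<x₀} E_A(x) > 0` and
  `b = Φ_A(x₁) := inf_{x>x₁} E_A(x)`, with `E_A(Ω_A) = ℂ ∖ [a, b]` (`image_extMap`) and the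
  holomorphic inverse `IsPlusHull.invExt` on `ℂ ∖ [a, b]` (`= Φ_A⁻¹` on `ℍ`);
* `IsPlusHull.leftVal_lt_rightVal` — **`a < b`**: otherwise `E_A⁻¹` would be holomorphic on
  `ℂ ∖ {a}` and bounded near `a`, hence entire (Riemann's removable singularity theorem,
  `Complex.differentiableOn_update_limUnder_of_bddAbove`) with `E_A⁻¹(w) - w` bounded, hence
  constant (Liouville, `Differentiable.apply_eq_apply_of_bounded`), forcing `K_A` to be a single
  point — but it contains `x₀` and a point of `A ∩ ℍ`;
* `IsPlusHull.exists_norm_extMap_le` — `E_A` is bounded on bounded parts of `Ω_A`;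
* `IsPlusHull.exists_infDist_extMap_lt` — **boundary behaviour**: `E_A(z) → [a, b]` as `z → K_A`
  (properness of the homeomorphism `E_A : Ω_A → ℂ ∖ [a, b]`), i.e. the sets
  `A ∪ Φ_A⁻¹(D_δ)` are neighbourhoods of `A' ∖ ∂` in `ℍ̄` as used on p. 13.

Mathlib: `extendFrom`, `Complex.differentiableOn_update_limUnder_of_bddAbove`,
`Differentiable.apply_eq_apply_of_bounded`, `Continuous.strictMono_of_inj`,
`isPreconnected_iff_ordConnected`; Literature: `HullUniformizer` (`IsSlitHull.ext` and its API),
`Complex.differentiableOn_invFunOn_image`.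
-/

noncomputable section

open Set Filter Topology Metric Bornology Complex
open UpperHalfPlane (upperHalfPlaneSet isOpen_upperHalfPlaneSet)
open scoped ComplexConjugate

namespace Literature.Probability.RandomPlanarGeometry

/-! ### Slit data of a nonempty `+`-hull -/

section SlitData

variable {A : Set ℂ}

/-- `x₀ = inf (A ∩ ℝ)`, the leftmost real point of a hull `A` ([LSW] proof of Lemma 3.5, p. 13:
"`x₀ := inf (A ∩ ℝ)`"). [cite: LawlerSchrammWerner2003Restriction, proof of Lemma 3.5 (p. 13)] -/
def leftPt (A : Set ℂ) : ℝ := sInf (realTrace A)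

/-- `x₁ = sup (A ∩ ℝ)`, the rightmost real point of a hull `A` ([LSW] proof of Lemma 3.5, p. 13:
"`x₁ := sup (A ∩ ℝ)`"). [cite: LawlerSchrammWerner2003Restriction, proof of Lemma 3.5 (p. 13)] -/
def rightPt (A : Set ℂ) : ℝ := sSup (realTrace A)

/-- `A' = A ∪ [x₀, x₁]` in terms of `leftPt`, `rightPt`. [folklore] -/
theorem realFill_eq (A : Set ℂ) :
    realFill A = A ∪ (fun x : ℝ ↦ (x : ℂ)) '' Icc (leftPt A) (rightPt A) := rfl

/-- A real point off the closed set `A` is in the closure of `ℍ ∖ A` (approach vertically). [folklore] -/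
theorem ofReal_mem_closure_diff (hAc : IsClosed A) {x : ℝ} (hx : (x : ℂ) ∉ A) :
    (x : ℂ) ∈ closure (upperHalfPlaneSet \ A) := by
  have hpath : Tendsto (fun t : ℝ ↦ (x : ℂ) + t * I) (𝓝[>] 0) (𝓝 (x : ℂ)) := by
    have : Continuous fun t : ℝ ↦ (x : ℂ) + t * I := by fun_prop
    simpa using (this.tendsto 0).mono_left nhdsWithin_le_nhds
  refine mem_closure_of_tendsto hpath ?_
  have hAo : ∀ᶠ t : ℝ in 𝓝[>] 0, (x : ℂ) + t * I ∈ Aᶜ :=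
    hpath (hAc.isOpen_compl.mem_nhds hx)
  filter_upwards [hAo, self_mem_nhdsWithin] with t htA ht
  exact ⟨show 0 < ((x : ℂ) + t * I).im by simpa using ht, htA⟩

variable (hA : IsPlusHull A)
include hA

/-- The real trace of a `+`-hull is compact. [folklore] -/
theorem IsPlusHull.isCompact_realTrace : IsCompact (realTrace A) :=
  Literature.Probability.RandomPlanarGeometry.isCompact_realTrace hA.1.isBoundedHull.isCompact

/-- Real points of `A` are at least `x₀`. [folklore] -/
theorem IsPlusHull.leftPt_le {x : ℝ} (hx : (x : ℂ) ∈ A) : leftPt A ≤ x :=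
  csInf_le hA.isCompact_realTrace.bddBelow hx

/-- Real points of `A` are at most `x₁`. [folklore] -/
theorem IsPlusHull.le_rightPt {x : ℝ} (hx : (x : ℂ) ∈ A) : x ≤ rightPt A :=
  le_csSup hA.isCompact_realTrace.bddAbove hx

/-- Points of a `+`-hull have nonnegative imaginary part. [folklore] -/
theorem IsPlusHull.im_nonneg {z : ℂ} (hz : z ∈ A) : 0 ≤ z.im := by
  have := hA.1.isBoundedHull.subset_closure hz
  rwa [show upperHalfPlaneSet = {z : ℂ | 0 < z.im} from rfl, closure_setOf_lt_im] at this

variable (hne : A.Nonempty)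
include hne

/-- A nonempty `+`-hull has real points. [folklore] -/
theorem IsPlusHull.realTrace_nonempty : (realTrace A).Nonempty :=
  hA.1.isBoundedHull.realTrace_nonempty hne

/-- `x₀ ∈ A`. [folklore] -/
theorem IsPlusHull.leftPt_mem : ((leftPt A : ℝ) : ℂ) ∈ A :=
  hA.isCompact_realTrace.sInf_mem (hA.realTrace_nonempty hne)

/-- `x₁ ∈ A`. [folklore] -/
theorem IsPlusHull.rightPt_mem : ((rightPt A : ℝ) : ℂ) ∈ A :=
  hA.isCompact_realTrace.sSup_mem (hA.realTrace_nonempty hne)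

/-- `0 < x₀`. [folklore] -/
theorem IsPlusHull.leftPt_pos : 0 < leftPt A := hA.2 _ (hA.leftPt_mem hne)

/-- `x₀ ≤ x₁`. [folklore] -/
theorem IsPlusHull.leftPt_le_rightPt : leftPt A ≤ rightPt A := hA.leftPt_le (hA.rightPt_mem hne)

/-- `0 < x₁`. [folklore] -/
theorem IsPlusHull.rightPt_pos : 0 < rightPt A := (hA.leftPt_pos hne).trans_le (hA.leftPt_le_rightPt hne)

/-- **Slit data for a nonempty `+`-hull**: for every `p ∈ (0, x₀)`, `A` is a one-sided hull with
slit `[p, x₁]` in the sense of `IsSlitHull` (`HullUniformizer`). [folklore] -/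
theorem IsPlusHull.isSlitHull_of_lt {p : ℝ} (hp0 : 0 < p) (hp : p < leftPt A) : IsSlitHull A p (rightPt A) where
  isStarHull := hA.1
  nonempty := hne
  isConnected_union := hA.1.isBoundedHull.isConnected_union_im_nonpos
  zero_notMem_uIcc := by
    rw [uIcc_of_le (hp.le.trans (hA.leftPt_le_rightPt hne))]
    intro h
    linarith [h.1]
  mem_uIcc x hx := by
    rw [uIcc_of_le (hp.le.trans (hA.leftPt_le_rightPt hne))]
    refine ⟨⟨hp.le.trans (hA.leftPt_le hx), hA.le_rightPt hx⟩, fun hxp ↦ ?_⟩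
    have := hA.leftPt_le hx
    rw [hxp] at this
    linarith

/-- `0 < x₀ / 2`. [folklore] -/
theorem IsPlusHull.half_leftPt_pos : 0 < leftPt A / 2 := by linarith [hA.leftPt_pos hne]

/-- `x₀ / 2 < x₀`. [folklore] -/
theorem IsPlusHull.half_leftPt_lt : leftPt A / 2 < leftPt A := by linarith [hA.leftPt_pos hne]

/-- The base slit data `(x₀/2, x₁)`. [folklore] -/
theorem IsPlusHull.baseSlit : IsSlitHull A (leftPt A / 2) (rightPt A) :=
  hA.isSlitHull_of_lt hne (hA.half_leftPt_pos hne) (hA.half_leftPt_lt hne)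

end SlitData

/-! ### The symmetric compact set `K_A = A ∪ Ā ∪ [x₀, x₁]` and the domain `Ω_A = ℂ ∖ K_A` -/

section SymDomain

variable {A : Set ℂ}

/-- `K_A = A ∪ Ā ∪ [x₀, x₁]`: the symmetrisation of the real filling `A' = A ∪ [x₀, x₁]`. [folklore] -/
def plusCompact (A : Set ℂ) : Set ℂ := slitCompact A (leftPt A) (rightPt A)

/-- `Ω_A = ℂ ∖ K_A`, the symmetric domain on which `Φ_A` extends by Schwarz reflection. [folklore] -/
def plusDomain (A : Set ℂ) : Set ℂ := slitDomain A (leftPt A) (rightPt A)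

/-- `Ω_A = (K_A)ᶜ`. [folklore] -/
theorem plusDomain_eq_compl (A : Set ℂ) : plusDomain A = (plusCompact A)ᶜ := rfl

/-- `K_A` is conjugation-invariant. [folklore] -/
theorem conj_mem_plusCompact_iff {z : ℂ} : conj z ∈ plusCompact A ↔ z ∈ plusCompact A :=
  IsSlitHull.conj_mem_slitCompact_iff

/-- `Ω_A` is conjugation-invariant. [folklore] -/
theorem conj_mem_plusDomain_iff {z : ℂ} : conj z ∈ plusDomain A ↔ z ∈ plusDomain A :=
  IsSlitHull.conj_mem_slitDomain_iff

/-- Slit domains increase with the free endpoint: `p ≤ p'` gives `Ω_p ⊆ Ω_{p'}` (for `p' ≤ q`). [folklore] -/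
theorem slitDomain_mono {p p' q : ℝ} (hpp' : p ≤ p') (hp'q : p' ≤ q) :
    slitDomain A p q ⊆ slitDomain A p' q := by
  intro z hz hz'
  refine hz ?_
  rcases hz' with h | h
  · exact Or.inl h
  · refine Or.inr ?_
    rw [mem_realSeg_iff] at h ⊢
    rw [uIcc_of_le hp'q] at h
    rw [uIcc_of_le (hpp'.trans hp'q)]
    exact ⟨h.1, hpp'.trans h.2.1, h.2.2⟩

variable (hA : IsPlusHull A)
include hA

/-- In the open upper half-plane, `K_A` is `A`. [folklore] -/
theorem IsPlusHull.mem_plusCompact_iff_of_im_pos {z : ℂ} (hz : 0 < z.im) : z ∈ plusCompact A ↔ z ∈ A := by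
  refine ⟨?_, fun h ↦ Or.inl (Or.inl h)⟩
  rintro ((h | h) | h)
  · exact h
  · have := hA.im_nonneg h
    rw [conj_im] at this
    linarith
  · have := im_eq_zero_of_mem_realSeg h
    linarith

/-- In the open upper half-plane, `Ω_A` is `ℍ ∖ A`. [folklore] -/
theorem IsPlusHull.mem_plusDomain_iff_of_im_pos {z : ℂ} (hz : 0 < z.im) : z ∈ plusDomain A ↔ z ∉ A := by
  rw [plusDomain_eq_compl, mem_compl_iff, hA.mem_plusCompact_iff_of_im_pos hz]

/-- `Ω_A ∩ ℍ = ℍ ∖ A`. [folklore] -/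
theorem IsPlusHull.plusDomain_inter_eq : plusDomain A ∩ upperHalfPlaneSet = upperHalfPlaneSet \ A := by
  ext z
  exact ⟨fun ⟨hz, hzH⟩ ↦ ⟨hzH, (hA.mem_plusDomain_iff_of_im_pos hzH).1 hz⟩,
    fun hz ↦ ⟨(hA.mem_plusDomain_iff_of_im_pos hz.1).2 hz.2, hz.1⟩⟩

/-- `ℍ ∖ A ⊆ Ω_A`. [folklore] -/
theorem IsPlusHull.diff_subset_plusDomain : upperHalfPlaneSet \ A ⊆ plusDomain A := fun _ hz ↦
  (hA.mem_plusDomain_iff_of_im_pos hz.1).2 hz.2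

/-- `K_A` is compact. [folklore] -/
theorem IsPlusHull.isCompact_plusCompact : IsCompact (plusCompact A) := by
  refine (hA.1.isBoundedHull.isCompact.union ?_).union isCompact_realSeg
  have : {z : ℂ | conj z ∈ A} = conj '' A := by
    ext z
    constructor
    · intro hz
      exact ⟨conj z, hz, conj_conj z⟩
    · rintro ⟨w, hw, rfl⟩
      show conj (conj w) ∈ A
      rwa [conj_conj]
  rw [this]
  exact hA.1.isBoundedHull.isCompact.image continuous_conj

/-- `Ω_A` is open. [folklore] -/
theorem IsPlusHull.isOpen_plusDomain : IsOpen (plusDomain A) :=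
  hA.isCompact_plusCompact.isClosed.isOpen_compl

variable (hne : A.Nonempty)
include hne

/-- The real points of `K_A` are exactly `[x₀, x₁]`. [folklore] -/
theorem IsPlusHull.ofReal_mem_plusCompact_iff {x : ℝ} :
    (x : ℂ) ∈ plusCompact A ↔ x ∈ Icc (leftPt A) (rightPt A) := by
  rw [← uIcc_of_le (hA.leftPt_le_rightPt hne)]
  refine ⟨?_, fun hx ↦ Or.inr (ofReal_mem_realSeg.2 hx)⟩
  rintro ((hx | hx) | hx)
  · rw [uIcc_of_le (hA.leftPt_le_rightPt hne)]
    exact ⟨hA.leftPt_le hx, hA.le_rightPt hx⟩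
  · rw [mem_setOf_eq, conj_ofReal] at hx
    rw [uIcc_of_le (hA.leftPt_le_rightPt hne)]
    exact ⟨hA.leftPt_le hx, hA.le_rightPt hx⟩
  · exact ofReal_mem_realSeg.1 hx

/-- The real points of `Ω_A` are those off `[x₀, x₁]`. [folklore] -/
theorem IsPlusHull.ofReal_mem_plusDomain_iff {x : ℝ} :
    (x : ℂ) ∈ plusDomain A ↔ x < leftPt A ∨ rightPt A < x := by
  rw [plusDomain_eq_compl, mem_compl_iff, hA.ofReal_mem_plusCompact_iff hne, mem_Icc, not_and_or, not_le, not_le]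

/-- `K_A ∩ ℍ̄ = A' = A ∪ [x₀, x₁]`, the real filling. [folklore] -/
theorem IsPlusHull.plusCompact_inter_eq_realFill :
    plusCompact A ∩ {z : ℂ | 0 ≤ z.im} = realFill A := by
  ext z
  constructor
  · rintro ⟨hz, hz0⟩
    rcases (show 0 ≤ z.im from hz0).lt_or_eq with hpos | hzero
    · exact Or.inl ((hA.mem_plusCompact_iff_of_im_pos hpos).1 hz)
    · have hzre : ((z.re : ℝ) : ℂ) = z := Complex.ext (by simp) (by simp [hzero])
      rw [← hzre] at hz ⊢
      exact Or.inr ⟨z.re, (hA.ofReal_mem_plusCompact_iff hne).1 hz, rfl⟩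
  · rintro (hz | ⟨x, hx, rfl⟩)
    · exact ⟨Or.inl (Or.inl hz), hA.im_nonneg hz⟩
    · exact ⟨(hA.ofReal_mem_plusCompact_iff hne).2 hx, by simp⟩

/-- `A' ⊆ K_A`. [folklore] -/
theorem IsPlusHull.realFill_subset_plusCompact : realFill A ⊆ plusCompact A := by
  rw [← hA.plusCompact_inter_eq_realFill hne]
  exact inter_subset_left

/-- `0 ∈ Ω_A`. [folklore] -/
theorem IsPlusHull.zero_mem_plusDomain : (0 : ℂ) ∈ plusDomain A := by
  have := (hA.ofReal_mem_plusDomain_iff hne (x := 0)).2 (Or.inl (hA.leftPt_pos hne))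
  simpa using this

/-- `Ω_p ⊆ Ω_A` for slit data `p < x₀`. [folklore] -/
theorem IsPlusHull.slitDomain_subset_plusDomain {p : ℝ} (hp : p ≤ leftPt A) :
    slitDomain A p (rightPt A) ⊆ plusDomain A :=
  slitDomain_mono hp (hA.leftPt_le_rightPt hne)

/-- Every point of `Ω_A` lies in some `Ω_p`, `p ∈ [x₀/2, x₀)`. [folklore] -/
theorem IsPlusHull.exists_mem_slitDomain {z : ℂ} (hz : z ∈ plusDomain A) :
    ∃ p : ℝ, leftPt A / 2 ≤ p ∧ p < leftPt A ∧ z ∈ slitDomain A p (rightPt A) := by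
  by_cases hz0 : z ∈ slitDomain A (leftPt A / 2) (rightPt A)
  · exact ⟨leftPt A / 2, le_rfl, hA.half_leftPt_lt hne, hz0⟩
  · -- `z` is a real point of `[x₀/2, x₀)`
    have hzK : z ∈ slitCompact A (leftPt A / 2) (rightPt A) := not_notMem.1 hz0
    have hzr : z ∈ realSeg (leftPt A / 2) (rightPt A) := by
      rcases hzK with h | h
      · exact absurd (Or.inl h : z ∈ plusCompact A) hz
      · exact h
    rw [mem_realSeg_iff, uIcc_of_le ((hA.half_leftPt_lt hne).le.trans (hA.leftPt_le_rightPt hne))] at hzr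
    obtain ⟨hzim, hzre1, hzre2⟩ := hzr
    have hzeq : ((z.re : ℝ) : ℂ) = z := Complex.ext (by simp) (by simp [hzim])
    have hlt : z.re < leftPt A := by
      rcases (hA.ofReal_mem_plusDomain_iff hne (x := z.re)).1 (by rwa [hzeq]) with h | h
      · exact h
      · linarith
    refine ⟨(z.re + leftPt A) / 2, by linarith, by linarith, ?_⟩
    have hx0 : 0 < leftPt A := hA.leftPt_pos hne
    have h01 : leftPt A ≤ rightPt A := hA.leftPt_le_rightPt hne
    set x : ℝ := z.re with hx
    rw [← hzeq, (hA.isSlitHull_of_lt hne (by linarith) (by linarith)).ofReal_mem_slitDomain_iff,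
      uIcc_of_le (by linarith)]
    intro h
    linarith [h.1]

/-- Any two points of `Ω_A` lie in a common `Ω_p`, `p ∈ [x₀/2, x₀)`. [folklore] -/
theorem IsPlusHull.exists_mem_slitDomain₂ {z w : ℂ} (hz : z ∈ plusDomain A) (hw : w ∈ plusDomain A) :
    ∃ p : ℝ, leftPt A / 2 ≤ p ∧ p < leftPt A ∧ z ∈ slitDomain A p (rightPt A) ∧
      w ∈ slitDomain A p (rightPt A) := by
  obtain ⟨p, hp1, hp2, hzp⟩ := hA.exists_mem_slitDomain hne hz
  obtain ⟨p', hp1', hp2', hwp⟩ := hA.exists_mem_slitDomain hne hw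
  refine ⟨max p p', le_max_of_le_left hp1, max_lt hp2 hp2', ?_, ?_⟩
  · exact slitDomain_mono (le_max_left _ _) ((max_lt hp2 hp2').le.trans (hA.leftPt_le_rightPt hne)) hzp
  · exact slitDomain_mono (le_max_right _ _) ((max_lt hp2 hp2').le.trans (hA.leftPt_le_rightPt hne)) hwp

end SymDomain

/-! ### The Schwarz-reflection extension `E_A` of `Φ_A` to `Ω_A` -/

section Extension

variable {A : Set ℂ} (hA : IsPlusHull A) (hne : A.Nonempty)
include hA hne

/-- **The restriction map `Φ_A`** of a nonempty `+`-hull, constructed in `HullUniformizer` from the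
base slit data `(x₀/2, x₁)`. [cite: LawlerSchrammWerner2003Restriction, §2 p. 8 (the maps Φ_A)] -/
def IsPlusHull.baseMap : ConformalEquiv (upperHalfPlaneSet \ A) upperHalfPlaneSet :=
  (hA.baseSlit hne).restrictionMap

/-- `Φ_A` acts as the extension `E` of the base slit data. [folklore] -/
theorem IsPlusHull.baseMap_apply (z : ℂ) : hA.baseMap hne z = (hA.baseSlit hne).ext z := rfl

/-- `Φ_A` is a restriction map of `A`. [cite: LawlerSchrammWerner2003Restriction, §2 p. 8 (the maps Φ_A)] -/
theorem IsPlusHull.isRestrictionMap_baseMap : IsRestrictionMap A (hA.baseMap hne) :=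
  (hA.baseSlit hne).isRestrictionMap

/-- Every restriction map of `A` agrees with `Φ_A` on `ℍ ∖ A`. [cite: LawlerSchrammWerner2003Restriction, §2 p. 8 (uniqueness of Φ_A)] -/
theorem IsPlusHull.eqOn_baseMap {Ψ : ConformalEquiv (upperHalfPlaneSet \ A) upperHalfPlaneSet}
    (hΨ : IsRestrictionMap A Ψ) : EqOn Ψ (hA.baseMap hne) (upperHalfPlaneSet \ A) :=
  (hA.baseSlit hne).eqOn_restrictionMap hΨ

/-- All the extensions `E_p` agree with `Φ_A` on `ℍ ∖ A` (uniqueness of restriction maps). [folklore] -/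
theorem IsPlusHull.ext_eq_baseMap {p : ℝ} (hp0 : 0 < p) (hp : p < leftPt A) :
    EqOn (hA.isSlitHull_of_lt hne hp0 hp).ext (hA.baseMap hne) (upperHalfPlaneSet \ A) :=
  hA.eqOn_baseMap hne (hA.isSlitHull_of_lt hne hp0 hp).isRestrictionMap

/-- **The Schwarz-reflection extension `E_A : ℂ → ℂ` of `Φ_A`** ([LSW] proof of Lemma 3.5,
p. 12: "the maps may be extended … by Schwarz reflection in the real line"): on the closed upper
half-plane the extension of `Φ_A` by limits, below the real axis its reflection
`z ↦ conj (Φ_A (conj z))`. On `Ω_A = ℂ ∖ (A ∪ Ā ∪ [x₀, x₁])` it is an injective holomorphic map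
(it agrees with every `E_p` of `HullUniformizer` on `Ω_p`, `extMap_eq`); values on `K_A` are junk.
[cite: LawlerSchrammWerner2003Restriction, proof of Lemma 3.5 (p. 12, Schwarz reflection)] -/
def IsPlusHull.extMap (z : ℂ) : ℂ :=
  if 0 ≤ z.im then extendFrom (upperHalfPlaneSet \ A) (hA.baseMap hne) z
  else conj (extendFrom (upperHalfPlaneSet \ A) (hA.baseMap hne) (conj z))

/-- **`E_A = E_p` on `Ω_p`** for all slit data `p ∈ (0, x₀)`. [folklore] -/
theorem IsPlusHull.extMap_eq {p : ℝ} (hp0 : 0 < p) (hp : p < leftPt A) {z : ℂ}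
    (hz : z ∈ slitDomain A p (rightPt A)) : hA.extMap hne z = (hA.isSlitHull_of_lt hne hp0 hp).ext z := by
  set h := hA.isSlitHull_of_lt hne hp0 hp with hh
  have hH : EqOn (hA.baseMap hne) h.ext (upperHalfPlaneSet \ A) := fun w hw ↦ (hA.ext_eq_baseMap hne hp0 hp hw).symm
  -- the limit of `Φ_A` within `ℍ ∖ A` at a point of `Ω_p` in the closed upper half-plane
  have hlim : ∀ {w : ℂ}, w ∈ slitDomain A p (rightPt A) → 0 ≤ w.im →
      extendFrom (upperHalfPlaneSet \ A) (hA.baseMap hne) w = h.ext w := by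
    intro w hw hw0
    have hwA : w ∉ A := fun hwA ↦ hw (Or.inl (Or.inl hwA))
    have hcl : w ∈ closure (upperHalfPlaneSet \ A) := by
      rcases hw0.lt_or_eq with hpos | hzero
      · exact subset_closure ⟨hpos, hwA⟩
      · have hwre : ((w.re : ℝ) : ℂ) = w := Complex.ext (by simp) (by simp [hzero])
        rw [← hwre] at hwA ⊢
        exact ofReal_mem_closure_diff h.isClosed_A hwA
    refine extendFrom_eq hcl ?_
    have t1 : Tendsto h.ext (𝓝[upperHalfPlaneSet \ A] w) (𝓝 (h.ext w)) :=
      ((h.differentiableAt_ext hw).continuousAt.tendsto).mono_left nhdsWithin_le_nhds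
    exact t1.congr' (eventually_mem_nhdsWithin.mono fun w' hw' ↦ (hH hw').symm)
  by_cases hz0 : 0 ≤ z.im
  · rw [IsPlusHull.extMap, if_pos hz0, hlim hz hz0]
  · rw [IsPlusHull.extMap, if_neg hz0]
    have hcz : conj z ∈ slitDomain A p (rightPt A) := IsSlitHull.conj_mem_slitDomain_iff.2 hz
    have hcz0 : 0 ≤ (conj z).im := by
      rw [conj_im]
      linarith [not_le.1 hz0]
    rw [hlim hcz hcz0, h.ext_conj hz, conj_conj]

/-- `E_A = Φ_A` on `ℍ ∖ A`. [folklore] -/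
theorem IsPlusHull.extMap_of_mem_diff {z : ℂ} (hz : z ∈ upperHalfPlaneSet \ A) :
    hA.extMap hne z = hA.baseMap hne z := by
  rw [hA.extMap_eq hne (hA.half_leftPt_pos hne) (hA.half_leftPt_lt hne) ((hA.baseSlit hne).diff_subset_slitDomain hz)]
  rfl

/-- `E_A = E_{x₀/2}` on `Ω_{x₀/2}`. [folklore] -/
theorem IsPlusHull.extMap_eq_base {z : ℂ} (hz : z ∈ slitDomain A (leftPt A / 2) (rightPt A)) :
    hA.extMap hne z = (hA.baseSlit hne).ext z :=
  hA.extMap_eq hne (hA.half_leftPt_pos hne) (hA.half_leftPt_lt hne) hz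

/-- `E_A` agrees with `E_p` near every point of `Ω_p`. [folklore] -/
theorem IsPlusHull.extMap_eventuallyEq {p : ℝ} (hp0 : 0 < p) (hp : p < leftPt A) {z : ℂ}
    (hz : z ∈ slitDomain A p (rightPt A)) : hA.extMap hne =ᶠ[𝓝 z] (hA.isSlitHull_of_lt hne hp0 hp).ext :=
  Filter.eventually_of_mem ((hA.isSlitHull_of_lt hne hp0 hp).isOpen_slitDomain.mem_nhds hz)
    fun _ hw ↦ hA.extMap_eq hne hp0 hp hw

/-- `E_A` is holomorphic at every point of `Ω_A`. [folklore] -/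
theorem IsPlusHull.differentiableAt_extMap {z : ℂ} (hz : z ∈ plusDomain A) :
    DifferentiableAt ℂ (hA.extMap hne) z := by
  obtain ⟨p, hp1, hp2, hzp⟩ := hA.exists_mem_slitDomain hne hz
  have hp0 : 0 < p := lt_of_lt_of_le (hA.half_leftPt_pos hne) hp1
  exact ((hA.isSlitHull_of_lt hne hp0 hp2).differentiableAt_ext hzp).congr_of_eventuallyEq
    (hA.extMap_eventuallyEq hne hp0 hp2 hzp)

/-- `E_A` is holomorphic on `Ω_A`. [folklore] -/
theorem IsPlusHull.differentiableOn_extMap : DifferentiableOn ℂ (hA.extMap hne) (plusDomain A) :=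
  fun _ hz ↦ (hA.differentiableAt_extMap hne hz).differentiableWithinAt

/-- `E_A` is continuous on `Ω_A`. [folklore] -/
theorem IsPlusHull.continuousOn_extMap : ContinuousOn (hA.extMap hne) (plusDomain A) :=
  (hA.differentiableOn_extMap hne).continuousOn

/-- `E_A' ≠ 0` on `Ω_A`. [folklore] -/
theorem IsPlusHull.deriv_extMap_ne_zero {z : ℂ} (hz : z ∈ plusDomain A) : deriv (hA.extMap hne) z ≠ 0 := by
  obtain ⟨p, hp1, hp2, hzp⟩ := hA.exists_mem_slitDomain hne hz
  have hp0 : 0 < p := lt_of_lt_of_le (hA.half_leftPt_pos hne) hp1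
  rw [(hA.extMap_eventuallyEq hne hp0 hp2 hzp).deriv_eq]
  exact (hA.isSlitHull_of_lt hne hp0 hp2).deriv_ext_ne_zero hzp

/-- `E_A` is injective on `Ω_A`. [folklore] -/
theorem IsPlusHull.injOn_extMap : InjOn (hA.extMap hne) (plusDomain A) := by
  intro z hz w hw hzw
  obtain ⟨p, hp1, hp2, hzp, hwp⟩ := hA.exists_mem_slitDomain₂ hne hz hw
  have hp0 : 0 < p := lt_of_lt_of_le (hA.half_leftPt_pos hne) hp1
  rw [hA.extMap_eq hne hp0 hp2 hzp, hA.extMap_eq hne hp0 hp2 hwp] at hzw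
  exact (hA.isSlitHull_of_lt hne hp0 hp2).injOn_ext hzp hwp hzw

/-- `E_A` commutes with conjugation on `Ω_A`. [folklore] -/
theorem IsPlusHull.extMap_conj {z : ℂ} (hz : z ∈ plusDomain A) :
    hA.extMap hne (conj z) = conj (hA.extMap hne z) := by
  obtain ⟨p, hp1, hp2, hzp⟩ := hA.exists_mem_slitDomain hne hz
  have hp0 : 0 < p := lt_of_lt_of_le (hA.half_leftPt_pos hne) hp1
  rw [hA.extMap_eq hne hp0 hp2 hzp, hA.extMap_eq hne hp0 hp2 (IsSlitHull.conj_mem_slitDomain_iff.2 hzp),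
    (hA.isSlitHull_of_lt hne hp0 hp2).ext_conj hzp]

/-- `E_A` is real on the real points of `Ω_A`. [folklore] -/
theorem IsPlusHull.extMap_ofReal_im {x : ℝ} (hx : (x : ℂ) ∈ plusDomain A) : (hA.extMap hne x).im = 0 := by
  rw [← conj_eq_iff_im, ← hA.extMap_conj hne hx, conj_ofReal]

/-- A real point of `Ω_A` is mapped to the real point `re E_A(x)`. [folklore] -/
theorem IsPlusHull.extMap_ofReal_eq {x : ℝ} (hx : (x : ℂ) ∈ plusDomain A) :
    hA.extMap hne x = ((hA.extMap hne x).re : ℂ) :=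
  Complex.ext (by simp) (by simp [hA.extMap_ofReal_im hne hx])

/-- `E_A(0) = 0`. [folklore] -/
theorem IsPlusHull.extMap_zero : hA.extMap hne 0 = 0 := by
  rw [hA.extMap_eq_base hne (hA.baseSlit hne).zero_mem_slitDomain, (hA.baseSlit hne).ext_zero]

/-- `E_A` maps `ℍ ∖ A` bijectively onto `ℍ`. [folklore] -/
theorem IsPlusHull.bijOn_extMap : BijOn (hA.extMap hne) (upperHalfPlaneSet \ A) upperHalfPlaneSet :=
  (hA.baseSlit hne).bijOn_ext.congr fun _ hz ↦ (hA.extMap_of_mem_diff hne hz).symm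

/-- `E_A` maps `ℍ ∖ A` into `ℍ`. [folklore] -/
theorem IsPlusHull.extMap_mem_of_mem_diff {z : ℂ} (hz : z ∈ upperHalfPlaneSet \ A) :
    hA.extMap hne z ∈ upperHalfPlaneSet :=
  (hA.bijOn_extMap hne).mapsTo hz

/-- **`E_A` preserves the sign of the imaginary part**: for `z ∈ Ω_A`, `im E_A(z) > 0 ↔ im z > 0`. [folklore] -/
theorem IsPlusHull.extMap_im_pos_iff {z : ℂ} (hz : z ∈ plusDomain A) : 0 < (hA.extMap hne z).im ↔ 0 < z.im := by
  rcases lt_trichotomy z.im 0 with hneg | hzero | hpos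
  · have hcz : conj z ∈ upperHalfPlaneSet \ A := by
      have h1 : 0 < (conj z).im := by rw [conj_im]; linarith
      exact ⟨h1, (hA.mem_plusDomain_iff_of_im_pos h1).1 (conj_mem_plusDomain_iff.2 hz)⟩
    have h2 : 0 < (hA.extMap hne (conj z)).im := hA.extMap_mem_of_mem_diff hne hcz
    rw [hA.extMap_conj hne hz, conj_im] at h2
    constructor
    · intro h; linarith
    · intro h; linarith
  · have hzre : ((z.re : ℝ) : ℂ) = z := Complex.ext (by simp) (by simp [hzero])
    have := hA.extMap_ofReal_im hne (x := z.re) (by rwa [hzre])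
    rw [hzre] at this
    rw [this, hzero]
  · exact ⟨fun _ ↦ hpos, fun _ ↦ hA.extMap_mem_of_mem_diff hne ⟨hpos, (hA.mem_plusDomain_iff_of_im_pos hpos).1 hz⟩⟩

/-- For `z ∈ Ω_A`, `im E_A(z) < 0 ↔ im z < 0`. [folklore] -/
theorem IsPlusHull.extMap_im_neg_iff {z : ℂ} (hz : z ∈ plusDomain A) : (hA.extMap hne z).im < 0 ↔ z.im < 0 := by
  have h1 := hA.extMap_im_pos_iff hne (conj_mem_plusDomain_iff.2 hz)
  rw [hA.extMap_conj hne hz, conj_im, conj_im] at h1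
  constructor
  · intro h; linarith [h1.1 (by linarith)]
  · intro h; linarith [h1.2 (by linarith)]

/-- For `z ∈ Ω_A`, `im E_A(z) = 0 ↔ im z = 0`. [folklore] -/
theorem IsPlusHull.extMap_im_eq_zero_iff {z : ℂ} (hz : z ∈ plusDomain A) : (hA.extMap hne z).im = 0 ↔ z.im = 0 := by
  have h1 := hA.extMap_im_pos_iff hne hz
  have h2 := hA.extMap_im_neg_iff hne hz
  constructor
  · intro h
    rcases lt_trichotomy z.im 0 with hn | hz0 | hp
    · linarith [h2.2 hn]
    · exact hz0
    · linarith [h1.2 hp]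
  · intro h
    rcases lt_trichotomy (hA.extMap hne z).im 0 with hn | hz0 | hp
    · linarith [h2.1 hn]
    · exact hz0
    · linarith [h1.1 hp]

/-- `E_A = E_{x₀/2}` eventually along `cocompact ℂ` (off the compact `K_{x₀/2}`). [folklore] -/
theorem IsPlusHull.extMap_eventuallyEq_cocompact :
    hA.extMap hne =ᶠ[cocompact ℂ] (hA.baseSlit hne).ext :=
  Filter.eventually_of_mem (hA.baseSlit hne).isCompact_slitCompact.compl_mem_cocompact
    fun _ hz ↦ hA.extMap_eq_base hne hz

/-- **Normalisation at `∞`**: `E_A(z)/z → 1` as `z → ∞`. [cite: LawlerSchrammWerner2003Restriction, §2 p. 8 (Φ(z)/z → 1)] -/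
theorem IsPlusHull.tendsto_extMap_div : Tendsto (fun z ↦ hA.extMap hne z / z) (cocompact ℂ) (𝓝 1) :=
  (hA.baseSlit hne).tendsto_ext_div.congr' ((hA.extMap_eventuallyEq_cocompact hne).mono fun z hz ↦ by
    simp only [hz])

/-- `E_A(z) - z → L ∈ ℝ` as `z → ∞`. [folklore] -/
theorem IsPlusHull.exists_tendsto_extMap_sub :
    ∃ L : ℝ, Tendsto (fun z ↦ hA.extMap hne z - z) (cocompact ℂ) (𝓝 (L : ℂ)) := by
  obtain ⟨L, hL⟩ := (hA.baseSlit hne).exists_tendsto_ext_sub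
  exact ⟨L, hL.congr' ((hA.extMap_eventuallyEq_cocompact hne).mono fun z hz ↦ by simp only [hz])⟩

/-- Far out, `E_A(z)/z` is within `1/2` of `1`. [folklore] -/
theorem IsPlusHull.exists_norm_extMap_div_sub_one_lt :
    ∃ R : ℝ, 0 < R ∧ ∀ z : ℂ, R ≤ ‖z‖ → ‖hA.extMap hne z / z - 1‖ < 1 / 2 := by
  have h1 : ∀ᶠ z in cocompact ℂ, dist (hA.extMap hne z / z) 1 < 1 / 2 :=
    hA.tendsto_extMap_div hne (Metric.ball_mem_nhds _ (by norm_num))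
  rw [← Metric.cobounded_eq_cocompact, Filter.hasBasis_cobounded_norm.eventually_iff] at h1
  obtain ⟨r, -, hr⟩ := h1
  refine ⟨max r 1, by positivity, fun z hz ↦ ?_⟩
  rw [← dist_eq_norm]
  exact hr ((le_max_left _ _).trans hz)

/-- Far out, `‖E_A(z)‖ ≥ ‖z‖/2`. [folklore] -/
theorem IsPlusHull.exists_norm_le_norm_extMap :
    ∃ R : ℝ, 0 < R ∧ ∀ z : ℂ, R ≤ ‖z‖ → ‖z‖ / 2 ≤ ‖hA.extMap hne z‖ := by
  obtain ⟨R, hR, h⟩ := hA.exists_norm_extMap_div_sub_one_lt hne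
  refine ⟨R, hR, fun z hz ↦ ?_⟩
  have hz0 : z ≠ 0 := by
    rintro rfl
    rw [norm_zero] at hz
    linarith
  have h1 := h z hz
  have h3 : 1 / 2 ≤ ‖hA.extMap hne z / z‖ := by
    have := norm_sub_norm_le (1 : ℂ) (hA.extMap hne z / z)
    rw [norm_one, norm_sub_rev] at this
    linarith
  rw [norm_div, le_div_iff₀ (norm_pos_iff.2 hz0)] at h3
  linarith

end Extension

/-! ### The real trace of `E_A`: monotonicity, the endpoints `a = Φ_A(x₀)`, `b = Φ_A(x₁)` -/

section RealTrace

variable {A : Set ℂ} (hA : IsPlusHull A) (hne : A.Nonempty)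
include hA hne

/-- The real trace `x ↦ re E_A(x)` of the extension. [folklore] -/
def IsPlusHull.realExt (x : ℝ) : ℝ := (hA.extMap hne x).re

/-- On real points of `Ω_A`, `E_A(x) = realExt x`. [folklore] -/
theorem IsPlusHull.extMap_ofReal {x : ℝ} (hx : (x : ℂ) ∈ plusDomain A) :
    hA.extMap hne x = (hA.realExt hne x : ℂ) :=
  hA.extMap_ofReal_eq hne hx

/-- `realExt 0 = 0`. [folklore] -/
theorem IsPlusHull.realExt_zero : hA.realExt hne 0 = 0 := by
  simp [IsPlusHull.realExt, hA.extMap_zero hne]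

/-- Real points left of `x₀` lie in `Ω_A`. [folklore] -/
theorem IsPlusHull.ofReal_mem_plusDomain_of_lt {x : ℝ} (hx : x < leftPt A) : (x : ℂ) ∈ plusDomain A :=
  (hA.ofReal_mem_plusDomain_iff hne).2 (Or.inl hx)

/-- Real points right of `x₁` lie in `Ω_A`. [folklore] -/
theorem IsPlusHull.ofReal_mem_plusDomain_of_gt {x : ℝ} (hx : rightPt A < x) : (x : ℂ) ∈ plusDomain A :=
  (hA.ofReal_mem_plusDomain_iff hne).2 (Or.inr hx)

/-- The real trace is continuous on `(-∞, x₀)`. [folklore] -/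
theorem IsPlusHull.continuousOn_realExt_Iio : ContinuousOn (hA.realExt hne) (Iio (leftPt A)) :=
  continuous_re.comp_continuousOn ((hA.continuousOn_extMap hne).comp continuous_ofReal.continuousOn
    fun _ hx ↦ hA.ofReal_mem_plusDomain_of_lt hne hx)

/-- The real trace is continuous on `(x₁, ∞)`. [folklore] -/
theorem IsPlusHull.continuousOn_realExt_Ioi : ContinuousOn (hA.realExt hne) (Ioi (rightPt A)) :=
  continuous_re.comp_continuousOn ((hA.continuousOn_extMap hne).comp continuous_ofReal.continuousOn
    fun _ hx ↦ hA.ofReal_mem_plusDomain_of_gt hne hx)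

/-- The real trace is injective on the real points of `Ω_A`. [folklore] -/
theorem IsPlusHull.realExt_injOn : InjOn (hA.realExt hne) {x | (x : ℂ) ∈ plusDomain A} := by
  intro x hx y hy hxy
  have : hA.extMap hne x = hA.extMap hne y := by
    rw [hA.extMap_ofReal hne hx, hA.extMap_ofReal hne hy, hxy]
  exact_mod_cast hA.injOn_extMap hne hx hy this

/-- Far out on the real axis, `realExt x ≤ x/2` for `x < 0` and `x/2 ≤ realExt x` for `x > 0`
(from `E_A(z)/z → 1`). [folklore] -/
theorem IsPlusHull.exists_realExt_bounds : ∃ R : ℝ, 0 < R ∧ (∀ x : ℝ, x ≤ -R → hA.realExt hne x ≤ x / 2) ∧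
    ∀ x : ℝ, R ≤ x → x / 2 ≤ hA.realExt hne x := by
  obtain ⟨R₀, hR₀, h⟩ := hA.exists_norm_extMap_div_sub_one_lt hne
  set R : ℝ := max R₀ (rightPt A + 1) with hRdef
  have hRR₀ : R₀ ≤ R := le_max_left _ _
  have key : ∀ x : ℝ, R ≤ |x| → (x : ℂ) ∈ plusDomain A → |hA.realExt hne x / x - 1| < 1 / 2 := by
    intro x hx hxΩ
    have h1 := h x (by rw [norm_real, Real.norm_eq_abs]; exact hRR₀.trans hx)
    rw [hA.extMap_ofReal hne hxΩ, ← ofReal_div, ← ofReal_one, ← ofReal_sub, norm_real,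
      Real.norm_eq_abs] at h1
    exact h1
  refine ⟨R, lt_of_lt_of_le hR₀ hRR₀, fun x hx ↦ ?_, fun x hx ↦ ?_⟩
  · have hxneg : x < 0 := by linarith [lt_of_lt_of_le hR₀ hRR₀]
    have hxΩ : (x : ℂ) ∈ plusDomain A := hA.ofReal_mem_plusDomain_of_lt hne (hxneg.trans (hA.leftPt_pos hne))
    have h1 := key x (by rw [abs_of_neg hxneg]; linarith) hxΩ
    rw [abs_lt] at h1
    have h2 : 1 / 2 < hA.realExt hne x / x := by linarith [h1.1]
    rw [lt_div_iff_of_neg hxneg] at h2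
    linarith
  · have hxpos : 0 < x := lt_of_lt_of_le (lt_of_lt_of_le hR₀ hRR₀) hx
    have hxΩ : (x : ℂ) ∈ plusDomain A :=
      hA.ofReal_mem_plusDomain_of_gt hne (by linarith [le_max_right R₀ (rightPt A + 1)])
    have h1 := key x (by rw [abs_of_pos hxpos]; exact hx) hxΩ
    rw [abs_lt] at h1
    have h2 : 1 / 2 < hA.realExt hne x / x := by linarith [h1.1]
    rw [lt_div_iff₀ hxpos] at h2
    linarith

/-- **The real trace is strictly increasing on `(-∞, x₀)`** (continuous and injective, and
`realExt x → -∞` as `x → -∞` rules out `decreasing`). [folklore] -/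
theorem IsPlusHull.strictMonoOn_realExt_Iio : StrictMonoOn (hA.realExt hne) (Iio (leftPt A)) := by
  have hx0 : 0 < leftPt A := hA.leftPt_pos hne
  haveI : Inhabited (Iio (leftPt A)) := ⟨⟨0, hx0⟩⟩
  set g : Iio (leftPt A) → ℝ := Set.restrict (Iio (leftPt A)) (hA.realExt hne) with hg
  have hgc : Continuous g := (hA.continuousOn_realExt_Iio hne).restrict
  have hgi : Function.Injective g :=
    ((hA.realExt_injOn hne).mono fun x hx ↦ hA.ofReal_mem_plusDomain_of_lt hne hx).injective
  rcases Continuous.strictMono_of_inj hgc hgi with hmono | hanti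
  · exact strictMono_restrict.mp hmono
  · exfalso
    obtain ⟨R, hR, hneg, -⟩ := hA.exists_realExt_bounds hne
    have h1 : hA.realExt hne (-R) ≤ -R / 2 := hneg (-R) le_rfl
    have h2 : hA.realExt hne 0 < hA.realExt hne (-R) := by
      have := hanti (a := ⟨-R, show -R ∈ Iio (leftPt A) by simp; linarith⟩) (b := ⟨0, hx0⟩)
        (show (⟨-R, _⟩ : Iio (leftPt A)) < ⟨0, hx0⟩ from by simp [Subtype.mk_lt_mk]; linarith)
      exact this
    rw [hA.realExt_zero hne] at h2
    linarith

/-- **The real trace is strictly increasing on `(x₁, ∞)`.** [folklore] -/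
theorem IsPlusHull.strictMonoOn_realExt_Ioi : StrictMonoOn (hA.realExt hne) (Ioi (rightPt A)) := by
  have hx1 : rightPt A < rightPt A + 1 := by linarith
  haveI : Inhabited (Ioi (rightPt A)) := ⟨⟨rightPt A + 1, hx1⟩⟩
  set g : Ioi (rightPt A) → ℝ := Set.restrict (Ioi (rightPt A)) (hA.realExt hne) with hg
  have hgc : Continuous g := (hA.continuousOn_realExt_Ioi hne).restrict
  have hgi : Function.Injective g :=
    ((hA.realExt_injOn hne).mono fun x hx ↦ hA.ofReal_mem_plusDomain_of_gt hne hx).injective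
  rcases Continuous.strictMono_of_inj hgc hgi with hmono | hanti
  · exact strictMono_restrict.mp hmono
  · exfalso
    obtain ⟨R, hR, -, hpos⟩ := hA.exists_realExt_bounds hne
    -- compare `x₁ + 1` with a far point `t`
    set u : ℝ := hA.realExt hne (rightPt A + 1) with hu
    set t : ℝ := max R (max (rightPt A + 2) (2 * |u| + 1)) with ht
    have htR : R ≤ t := le_max_left _ _
    have ht1 : rightPt A + 1 < t := by
      have := le_max_left (rightPt A + 2) (2 * |u| + 1)
      have := le_max_right R (max (rightPt A + 2) (2 * |u| + 1))
      linarith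
    have h1 : t / 2 ≤ hA.realExt hne t := hpos t htR
    have h2 : hA.realExt hne t < u := by
      have := hanti (a := ⟨rightPt A + 1, hx1⟩) (b := ⟨t, show t ∈ Ioi (rightPt A) from lt_trans hx1 ht1⟩)
        (show (⟨rightPt A + 1, hx1⟩ : Ioi (rightPt A)) < ⟨t, _⟩ from ht1)
      exact this
    have h3 : 2 * |u| + 1 ≤ t := (le_max_right _ _).trans (le_max_right _ _)
    linarith [le_abs_self u]


/-- The image of `(x₁, ∞)` under the real trace is order-connected. [folklore] -/
theorem IsPlusHull.ordConnected_image_Ioi : (hA.realExt hne '' Ioi (rightPt A)).OrdConnected :=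
  isPreconnected_iff_ordConnected.1 (isPreconnected_Ioi.image _ (hA.continuousOn_realExt_Ioi hne))

/-- The image of `(-∞, x₀)` under the real trace is order-connected. [folklore] -/
theorem IsPlusHull.ordConnected_image_Iio : (hA.realExt hne '' Iio (leftPt A)).OrdConnected :=
  isPreconnected_iff_ordConnected.1 (isPreconnected_Iio.image _ (hA.continuousOn_realExt_Iio hne))

/-- **Values left of `x₀` are below values right of `x₁`** (the two image intervals are disjoint by
injectivity of `E_A`, the right one is unbounded above). [folklore] -/
theorem IsPlusHull.realExt_lt_realExt {x y : ℝ} (hx : x < leftPt A) (hy : rightPt A < y) :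
    hA.realExt hne x < hA.realExt hne y := by
  by_contra hle
  push Not at hle
  have hxΩ := hA.ofReal_mem_plusDomain_of_lt hne hx
  have hyΩ := hA.ofReal_mem_plusDomain_of_gt hne hy
  have hne' : hA.realExt hne y ≠ hA.realExt hne x := fun h ↦ by
    have := hA.realExt_injOn hne hyΩ hxΩ h
    linarith [hA.leftPt_le_rightPt hne]
  have hlt : hA.realExt hne y < hA.realExt hne x := lt_of_le_of_ne hle hne'
  -- a far point `t > x₁` with a larger value
  obtain ⟨R, hR, -, hpos⟩ := hA.exists_realExt_bounds hne
  set u := hA.realExt hne x with hu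
  set t : ℝ := max R (max (rightPt A + 1) (2 * |u| + 1)) with ht
  have ht1 : rightPt A < t := by
    have h1 := le_max_left (rightPt A + 1) (2 * |u| + 1)
    have h2 := le_max_right R (max (rightPt A + 1) (2 * |u| + 1))
    linarith
  have htu : u < hA.realExt hne t := by
    have h1 : t / 2 ≤ hA.realExt hne t := hpos t (le_max_left _ _)
    have h3 : 2 * |u| + 1 ≤ t := (le_max_right _ _).trans (le_max_right _ _)
    linarith [le_abs_self u]
  -- so `u` is a value on `(x₁, ∞)`, contradicting injectivity
  have hmem : u ∈ hA.realExt hne '' Ioi (rightPt A) :=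
    (hA.ordConnected_image_Ioi hne).out ⟨y, hy, rfl⟩ ⟨t, ht1, rfl⟩ ⟨hlt.le, htu.le⟩
  obtain ⟨x', hx', hx'u⟩ := hmem
  have := hA.realExt_injOn hne (hA.ofReal_mem_plusDomain_of_gt hne hx') hxΩ hx'u
  rw [← this] at hx
  linarith [hA.leftPt_le_rightPt hne, hx'.out]

/-- The values on `(-∞, x₀)` are bounded above. [folklore] -/
theorem IsPlusHull.bddAbove_image_Iio : BddAbove (hA.realExt hne '' Iio (leftPt A)) :=
  ⟨hA.realExt hne (rightPt A + 1), by
    rintro _ ⟨x, hx, rfl⟩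
    exact (hA.realExt_lt_realExt hne hx (by linarith)).le⟩

/-- The values on `(x₁, ∞)` are bounded below (by `0 = realExt 0`). [folklore] -/
theorem IsPlusHull.bddBelow_image_Ioi : BddBelow (hA.realExt hne '' Ioi (rightPt A)) :=
  ⟨0, by
    rintro _ ⟨y, hy, rfl⟩
    rw [← hA.realExt_zero hne]
    exact (hA.realExt_lt_realExt hne (hA.leftPt_pos hne) hy).le⟩

/-- **`a = Φ_A(x₀)`**: the supremum of the real trace over `(-∞, x₀)`, i.e. its limit at `x₀⁻`
([LSW] proof of Lemma 3.5, p. 13: the left endpoint of "`[Φ_A(x₀), Φ_A(x₁)]`").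
[cite: LawlerSchrammWerner2003Restriction, proof of Lemma 3.5 (p. 13)] -/
def IsPlusHull.leftVal : ℝ := sSup (hA.realExt hne '' Iio (leftPt A))

/-- **`b = Φ_A(x₁)`**: the infimum of the real trace over `(x₁, ∞)`, i.e. its limit at `x₁⁺`
([LSW] proof of Lemma 3.5, p. 13: the right endpoint of "`[Φ_A(x₀), Φ_A(x₁)]`").
[cite: LawlerSchrammWerner2003Restriction, proof of Lemma 3.5 (p. 13)] -/
def IsPlusHull.rightVal : ℝ := sInf (hA.realExt hne '' Ioi (rightPt A))

/-- `realExt x < a` for `x < x₀`. [folklore] -/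
theorem IsPlusHull.realExt_lt_leftVal {x : ℝ} (hx : x < leftPt A) : hA.realExt hne x < hA.leftVal hne := by
  have h1 : hA.realExt hne x < hA.realExt hne ((x + leftPt A) / 2) :=
    hA.strictMonoOn_realExt_Iio hne hx (show (x + leftPt A) / 2 < leftPt A by linarith) (by linarith)
  exact lt_of_lt_of_le h1 (le_csSup (hA.bddAbove_image_Iio hne) ⟨_, by
    show (x + leftPt A) / 2 < leftPt A; linarith, rfl⟩)

/-- `b < realExt y` for `x₁ < y`. [folklore] -/
theorem IsPlusHull.rightVal_lt_realExt {y : ℝ} (hy : rightPt A < y) : hA.rightVal hne < hA.realExt hne y := by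
  have h1 : hA.realExt hne ((rightPt A + y) / 2) < hA.realExt hne y :=
    hA.strictMonoOn_realExt_Ioi hne (show rightPt A < (rightPt A + y) / 2 by linarith) hy (by linarith)
  exact lt_of_le_of_lt (csInf_le (hA.bddBelow_image_Ioi hne) ⟨_, by
    show rightPt A < (rightPt A + y) / 2; linarith, rfl⟩) h1

/-- `0 < a` (`realExt 0 = 0` and `0 < x₀`). [folklore] -/
theorem IsPlusHull.leftVal_pos : 0 < hA.leftVal hne := by
  have := hA.realExt_lt_leftVal hne (hA.leftPt_pos hne)
  rwa [hA.realExt_zero hne] at this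

/-- `a ≤ b`. [folklore] -/
theorem IsPlusHull.leftVal_le_rightVal : hA.leftVal hne ≤ hA.rightVal hne := by
  refine csSup_le ⟨_, ⟨0, hA.leftPt_pos hne, rfl⟩⟩ ?_
  rintro _ ⟨x, hx, rfl⟩
  refine le_csInf ⟨_, ⟨rightPt A + 1, by show rightPt A < rightPt A + 1; linarith, rfl⟩⟩ ?_
  rintro _ ⟨y, hy, rfl⟩
  exact (hA.realExt_lt_realExt hne hx hy).le

/-- Every `u < a` is a value `realExt x`, `x < x₀`. [folklore] -/
theorem IsPlusHull.exists_realExt_eq_of_lt_leftVal {u : ℝ} (hu : u < hA.leftVal hne) :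
    ∃ x : ℝ, x < leftPt A ∧ hA.realExt hne x = u := by
  have hu' : u < sSup (hA.realExt hne '' Iio (leftPt A)) := hu
  obtain ⟨_, ⟨y, hy, rfl⟩, huy⟩ :=
    exists_lt_of_lt_csSup (s := hA.realExt hne '' Iio (leftPt A)) ⟨_, ⟨0, hA.leftPt_pos hne, rfl⟩⟩ hu'
  obtain ⟨R, hR, hneg, -⟩ := hA.exists_realExt_bounds hne
  set x' : ℝ := -(R + 2 * |u| + 1) with hx'
  have hx'0 : x' < leftPt A := by
    have : x' < 0 := by rw [hx']; linarith [abs_nonneg u]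
    exact this.trans (hA.leftPt_pos hne)
  have hx'u : hA.realExt hne x' ≤ u := by
    have h1 : hA.realExt hne x' ≤ x' / 2 := hneg x' (by rw [hx']; linarith [abs_nonneg u])
    have h2 : x' / 2 ≤ u := by rw [hx']; linarith [neg_abs_le u]
    linarith
  obtain ⟨x, hx, hxu⟩ := (hA.ordConnected_image_Iio hne).out ⟨x', hx'0, rfl⟩ ⟨y, hy, rfl⟩ ⟨hx'u, huy.le⟩
  exact ⟨x, hx, hxu⟩

/-- Every `v > b` is a value `realExt y`, `y > x₁`. [folklore] -/
theorem IsPlusHull.exists_realExt_eq_of_rightVal_lt {v : ℝ} (hv : hA.rightVal hne < v) :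
    ∃ y : ℝ, rightPt A < y ∧ hA.realExt hne y = v := by
  have hv' : sInf (hA.realExt hne '' Ioi (rightPt A)) < v := hv
  obtain ⟨_, ⟨x, hx, rfl⟩, hxv⟩ :=
    exists_lt_of_csInf_lt (s := hA.realExt hne '' Ioi (rightPt A))
      ⟨_, ⟨rightPt A + 1, by show rightPt A < rightPt A + 1; linarith, rfl⟩⟩ hv'
  obtain ⟨R, hR, -, hpos⟩ := hA.exists_realExt_bounds hne
  set t : ℝ := max R (max (rightPt A + 1) (2 * |v| + 1)) with ht
  have ht1 : rightPt A < t := by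
    have h1 := le_max_left (rightPt A + 1) (2 * |v| + 1)
    have h2 := le_max_right R (max (rightPt A + 1) (2 * |v| + 1))
    linarith
  have htv : v ≤ hA.realExt hne t := by
    have h1 : t / 2 ≤ hA.realExt hne t := hpos t (le_max_left _ _)
    have h3 : 2 * |v| + 1 ≤ t := (le_max_right _ _).trans (le_max_right _ _)
    linarith [le_abs_self v]
  obtain ⟨y, hy, hyv⟩ := (hA.ordConnected_image_Ioi hne).out ⟨x, hx, rfl⟩ ⟨t, ht1, rfl⟩ ⟨hxv.le, htv⟩
  exact ⟨y, hy, hyv⟩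

/-! #### The image `E_A(Ω_A) = ℂ ∖ [a, b]` and the inverse map -/

/-- The segment `[a, b] = [Φ_A(x₀), Φ_A(x₁)]` ⊆ ℝ ⊆ ℂ. [cite: LawlerSchrammWerner2003Restriction, proof of Lemma 3.5 (p. 13)] -/
def IsPlusHull.valSeg : Set ℂ := realSeg (hA.leftVal hne) (hA.rightVal hne)

/-- Membership in `[a, b]`. [folklore] -/
theorem IsPlusHull.mem_valSeg_iff {w : ℂ} :
    w ∈ hA.valSeg hne ↔ w.im = 0 ∧ hA.leftVal hne ≤ w.re ∧ w.re ≤ hA.rightVal hne := by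
  rw [IsPlusHull.valSeg, mem_realSeg_iff, uIcc_of_le (hA.leftVal_le_rightVal hne), mem_Icc]

/-- `[a, b]` is compact. [folklore] -/
theorem IsPlusHull.isCompact_valSeg : IsCompact (hA.valSeg hne) := isCompact_realSeg

/-- `ℂ ∖ [a, b]` is open. [folklore] -/
theorem IsPlusHull.isOpen_compl_valSeg : IsOpen (hA.valSeg hne)ᶜ := (hA.isCompact_valSeg hne).isClosed.isOpen_compl

/-- `0 ∉ [a, b]`. [folklore] -/
theorem IsPlusHull.zero_notMem_valSeg : (0 : ℂ) ∉ hA.valSeg hne := by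
  rw [hA.mem_valSeg_iff hne]
  rintro ⟨-, h, -⟩
  simp at h
  linarith [hA.leftVal_pos hne]

/-- Points of `ℍ` are off `[a, b]`. [folklore] -/
theorem IsPlusHull.notMem_valSeg_of_im_pos {w : ℂ} (hw : 0 < w.im) : w ∉ hA.valSeg hne := by
  rw [hA.mem_valSeg_iff hne]
  rintro ⟨h, -⟩
  linarith

/-- **`E_A` maps `Ω_A` into `ℂ ∖ [a, b]`.** [folklore] -/
theorem IsPlusHull.extMap_notMem_valSeg {z : ℂ} (hz : z ∈ plusDomain A) : hA.extMap hne z ∉ hA.valSeg hne := by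
  rw [hA.mem_valSeg_iff hne]
  rintro ⟨him, h1, h2⟩
  have hzim : z.im = 0 := (hA.extMap_im_eq_zero_iff hne hz).1 him
  have hzre : ((z.re : ℝ) : ℂ) = z := Complex.ext (by simp) (by simp [hzim])
  rw [← hzre] at hz h1 h2
  have hre : (hA.extMap hne (z.re : ℝ)).re = hA.realExt hne z.re := rfl
  rw [hre] at h1 h2
  rcases (hA.ofReal_mem_plusDomain_iff hne).1 hz with hlt | hgt
  · linarith [hA.realExt_lt_leftVal hne hlt]
  · linarith [hA.rightVal_lt_realExt hne hgt]

/-- **`E_A` maps `Ω_A` ONTO `ℂ ∖ [a, b]`.** [folklore] -/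
theorem IsPlusHull.exists_extMap_eq {w : ℂ} (hw : w ∉ hA.valSeg hne) : ∃ z ∈ plusDomain A, hA.extMap hne z = w := by
  rcases lt_trichotomy w.im 0 with hneg | hzero | hpos
  · have hcw : conj w ∈ upperHalfPlaneSet := by
      show 0 < (conj w).im
      rw [conj_im]; linarith
    obtain ⟨z, hz, hzw⟩ := (hA.bijOn_extMap hne).surjOn hcw
    refine ⟨conj z, conj_mem_plusDomain_iff.2 (hA.diff_subset_plusDomain hz), ?_⟩
    rw [hA.extMap_conj hne (hA.diff_subset_plusDomain hz), hzw, conj_conj]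
  · have hwre : ((w.re : ℝ) : ℂ) = w := Complex.ext (by simp) (by simp [hzero])
    have hcases : w.re < hA.leftVal hne ∨ hA.rightVal hne < w.re := by
      by_contra h
      push Not at h
      exact hw ((hA.mem_valSeg_iff hne).2 ⟨hzero, h.1, h.2⟩)
    rcases hcases with hlt | hgt
    · obtain ⟨x, hx, hxw⟩ := hA.exists_realExt_eq_of_lt_leftVal hne hlt
      refine ⟨x, hA.ofReal_mem_plusDomain_of_lt hne hx, ?_⟩
      rw [hA.extMap_ofReal hne (hA.ofReal_mem_plusDomain_of_lt hne hx), hxw, hwre]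
    · obtain ⟨y, hy, hyw⟩ := hA.exists_realExt_eq_of_rightVal_lt hne hgt
      refine ⟨y, hA.ofReal_mem_plusDomain_of_gt hne hy, ?_⟩
      rw [hA.extMap_ofReal hne (hA.ofReal_mem_plusDomain_of_gt hne hy), hyw, hwre]
  · obtain ⟨z, hz, hzw⟩ := (hA.bijOn_extMap hne).surjOn (show w ∈ upperHalfPlaneSet from hpos)
    exact ⟨z, hA.diff_subset_plusDomain hz, hzw⟩

/-- **`E_A(Ω_A) = ℂ ∖ [a, b]`** ([LSW] p. 13: `Φ_A` maps `ℍ ∖ A` onto `ℍ` with the real filling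
`A'` corresponding to `[Φ_A(x₀), Φ_A(x₁)]`). [cite: LawlerSchrammWerner2003Restriction, proof of Lemma 3.5 (p. 13)] -/
theorem IsPlusHull.image_extMap : hA.extMap hne '' plusDomain A = (hA.valSeg hne)ᶜ := by
  ext w
  constructor
  · rintro ⟨z, hz, rfl⟩
    exact hA.extMap_notMem_valSeg hne hz
  · intro hw
    obtain ⟨z, hz, hzw⟩ := hA.exists_extMap_eq hne hw
    exact ⟨z, hz, hzw⟩

/-- **The inverse `E_A⁻¹ : ℂ ∖ [a, b] → Ω_A`** (junk elsewhere). [folklore] -/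
def IsPlusHull.invExt : ℂ → ℂ := Function.invFunOn (hA.extMap hne) (plusDomain A)

/-- `E_A⁻¹` is holomorphic on `ℂ ∖ [a, b]`. [folklore] -/
theorem IsPlusHull.differentiableOn_invExt : DifferentiableOn ℂ (hA.invExt hne) (hA.valSeg hne)ᶜ := by
  rw [← hA.image_extMap hne]
  exact Complex.differentiableOn_invFunOn_image hA.isOpen_plusDomain (hA.differentiableOn_extMap hne)
    (hA.injOn_extMap hne) fun _ hz ↦ hA.deriv_extMap_ne_zero hne hz

/-- `E_A⁻¹` is continuous on `ℂ ∖ [a, b]`. [folklore] -/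
theorem IsPlusHull.continuousOn_invExt : ContinuousOn (hA.invExt hne) (hA.valSeg hne)ᶜ :=
  (hA.differentiableOn_invExt hne).continuousOn

/-- `E_A⁻¹` is continuous at every point off `[a, b]`. [folklore] -/
theorem IsPlusHull.continuousAt_invExt {w : ℂ} (hw : w ∉ hA.valSeg hne) : ContinuousAt (hA.invExt hne) w :=
  (hA.continuousOn_invExt hne w hw).continuousAt ((hA.isOpen_compl_valSeg hne).mem_nhds hw)

/-- `E_A⁻¹ (E_A z) = z` on `Ω_A`. [folklore] -/
theorem IsPlusHull.invExt_extMap {z : ℂ} (hz : z ∈ plusDomain A) : hA.invExt hne (hA.extMap hne z) = z :=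
  (hA.injOn_extMap hne).leftInvOn_invFunOn hz

/-- `E_A (E_A⁻¹ w) = w` off `[a, b]`. [folklore] -/
theorem IsPlusHull.extMap_invExt {w : ℂ} (hw : w ∉ hA.valSeg hne) : hA.extMap hne (hA.invExt hne w) = w := by
  obtain ⟨z, hz, hzw⟩ := hA.exists_extMap_eq hne hw
  exact Function.invFunOn_eq ⟨z, hz, hzw⟩

/-- `E_A⁻¹` maps `ℂ ∖ [a, b]` into `Ω_A`. [folklore] -/
theorem IsPlusHull.invExt_mem {w : ℂ} (hw : w ∉ hA.valSeg hne) : hA.invExt hne w ∈ plusDomain A := by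
  obtain ⟨z, hz, hzw⟩ := hA.exists_extMap_eq hne hw
  exact Function.invFunOn_mem ⟨z, hz, hzw⟩

/-- `E_A⁻¹` is injective on `ℂ ∖ [a, b]`. [folklore] -/
theorem IsPlusHull.injOn_invExt : InjOn (hA.invExt hne) (hA.valSeg hne)ᶜ := by
  intro w hw w' hw' h
  rw [← hA.extMap_invExt hne hw, ← hA.extMap_invExt hne hw', h]

/-- On `ℍ`, `E_A⁻¹ = Φ_A⁻¹`. [folklore] -/
theorem IsPlusHull.invExt_eq_symm {w : ℂ} (hw : w ∈ upperHalfPlaneSet) :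
    hA.invExt hne w = (hA.baseMap hne).symm w := by
  have hw' : w ∉ hA.valSeg hne := hA.notMem_valSeg_of_im_pos hne hw
  have h1 : (hA.baseMap hne).symm w ∈ upperHalfPlaneSet \ A := (hA.baseMap hne).symm_mapsTo hw
  refine hA.injOn_extMap hne (hA.invExt_mem hne hw') (hA.diff_subset_plusDomain h1) ?_
  rw [hA.extMap_invExt hne hw', hA.extMap_of_mem_diff hne h1, (hA.baseMap hne).apply_symm_apply hw]

/-- For `w ∉ [a, b]`: `im E_A⁻¹(w) > 0 ↔ im w > 0`. [folklore] -/
theorem IsPlusHull.invExt_im_pos_iff {w : ℂ} (hw : w ∉ hA.valSeg hne) : 0 < (hA.invExt hne w).im ↔ 0 < w.im := by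
  have := hA.extMap_im_pos_iff hne (hA.invExt_mem hne hw)
  rw [hA.extMap_invExt hne hw] at this
  exact this.symm

/-- For `w ∉ [a, b]`: `im E_A⁻¹(w) = 0 ↔ im w = 0`. [folklore] -/
theorem IsPlusHull.invExt_im_eq_zero_iff {w : ℂ} (hw : w ∉ hA.valSeg hne) :
    (hA.invExt hne w).im = 0 ↔ w.im = 0 := by
  have := hA.extMap_im_eq_zero_iff hne (hA.invExt_mem hne hw)
  rw [hA.extMap_invExt hne hw] at this
  exact this.symm

/-- `E_A⁻¹` maps `ℍ` into `ℍ ∖ A`. [folklore] -/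
theorem IsPlusHull.invExt_mem_diff {w : ℂ} (hw : w ∈ upperHalfPlaneSet) : hA.invExt hne w ∈ upperHalfPlaneSet \ A := by
  rw [hA.invExt_eq_symm hne hw]
  exact (hA.baseMap hne).symm_mapsTo hw

/-- `E_A⁻¹ 0 = 0`. [folklore] -/
theorem IsPlusHull.invExt_zero : hA.invExt hne 0 = 0 := by
  have := hA.invExt_extMap hne (hA.zero_mem_plusDomain hne)
  rwa [hA.extMap_zero hne] at this

/-- **A real point `w < a` comes from a real point left of `x₀`.** [folklore] -/
theorem IsPlusHull.invExt_of_lt_leftVal {w : ℝ} (hw : w < hA.leftVal hne) :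
    ∃ x : ℝ, x < leftPt A ∧ hA.invExt hne w = x ∧ hA.realExt hne x = w := by
  obtain ⟨x, hx, hxw⟩ := hA.exists_realExt_eq_of_lt_leftVal hne hw
  refine ⟨x, hx, ?_, hxw⟩
  have hxΩ := hA.ofReal_mem_plusDomain_of_lt hne hx
  have := hA.invExt_extMap hne hxΩ
  rwa [hA.extMap_ofReal hne hxΩ, hxw] at this

/-- **A real point `w > b` comes from a real point right of `x₁`.** [folklore] -/
theorem IsPlusHull.invExt_of_rightVal_lt {w : ℝ} (hw : hA.rightVal hne < w) :
    ∃ y : ℝ, rightPt A < y ∧ hA.invExt hne w = y ∧ hA.realExt hne y = w := by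
  obtain ⟨y, hy, hyw⟩ := hA.exists_realExt_eq_of_rightVal_lt hne hw
  refine ⟨y, hy, ?_, hyw⟩
  have hyΩ := hA.ofReal_mem_plusDomain_of_gt hne hy
  have := hA.invExt_extMap hne hyΩ
  rwa [hA.extMap_ofReal hne hyΩ, hyw] at this

end RealTrace

/-! ### Local boundedness, `a < b`, and the boundary behaviour of `E_A` at `K_A` -/

section Boundary

variable {A : Set ℂ} (hA : IsPlusHull A) (hne : A.Nonempty)
include hA hne

/-- `Φ_A⁻¹` maps far points of `ℍ` to far points: `‖Φ_A⁻¹ w‖ ≤ R ⇒ ‖w‖ < r(R)` (from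
`tendsto_symm_cocompact` of `HullUniformizer`). [folklore] -/
theorem IsPlusHull.exists_norm_lt_of_norm_symm_le (R : ℝ) :
    ∃ r : ℝ, ∀ w ∈ upperHalfPlaneSet, ‖(hA.baseMap hne).symm w‖ ≤ R → ‖w‖ < r := by
  have h := (hA.baseSlit hne).tendsto_symm_cocompact
  have hmem : (closedBall (0 : ℂ) R)ᶜ ∈ cocompact ℂ := (isCompact_closedBall 0 R).compl_mem_cocompact
  have h1 := h hmem
  rw [Filter.mem_map, Filter.mem_inf_principal, ← cobounded_eq_cocompact] at h1
  obtain ⟨r, -, hr⟩ := (Filter.hasBasis_cobounded_norm.mem_iff).1 h1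
  refine ⟨r, fun w hw hwR ↦ ?_⟩
  by_contra hlt
  push Not at hlt
  have := hr hlt hw
  simp only [mem_preimage, mem_compl_iff, mem_closedBall, dist_zero_right, not_le] at this
  exact absurd hwR (not_le.2 this)

/-- **`E_A` is bounded on bounded parts of `Ω_A`** (no blow-up at `K_A`: in `ℍ` by the behaviour
of `Φ_A⁻¹` at `∞`, below by symmetry, on the real axis by monotonicity). [folklore] -/
theorem IsPlusHull.exists_norm_extMap_le (R : ℝ) :
    ∃ M : ℝ, ∀ z ∈ plusDomain A, ‖z‖ ≤ R → ‖hA.extMap hne z‖ ≤ M := by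
  obtain ⟨r, hr⟩ := hA.exists_norm_lt_of_norm_symm_le hne R
  set M₂ : ℝ := |hA.realExt hne (-R - 1)| + |hA.leftVal hne| + |hA.rightVal hne| + |hA.realExt hne (R + 1)|
    with hM₂
  refine ⟨max r M₂, fun z hz hzR ↦ ?_⟩
  -- the upper half-plane case, used twice
  have hup : ∀ {w : ℂ}, w ∈ upperHalfPlaneSet \ A → ‖w‖ ≤ R → ‖hA.extMap hne w‖ < r := by
    intro w hw hwR
    have h1 : (hA.baseMap hne).symm (hA.extMap hne w) = w := by
      rw [hA.extMap_of_mem_diff hne hw, (hA.baseMap hne).symm_apply_apply hw]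
    exact hr _ (hA.extMap_mem_of_mem_diff hne hw) (by rw [h1]; exact hwR)
  rcases lt_trichotomy z.im 0 with hneg | hzero | hpos
  · have hcz : conj z ∈ upperHalfPlaneSet \ A := by
      have h1 : 0 < (conj z).im := by rw [conj_im]; linarith
      exact ⟨h1, (hA.mem_plusDomain_iff_of_im_pos h1).1 (conj_mem_plusDomain_iff.2 hz)⟩
    have h2 := hup hcz (by rwa [norm_conj])
    rw [hA.extMap_conj hne hz, norm_conj] at h2
    exact h2.le.trans (le_max_left _ _)
  · have hzre : ((z.re : ℝ) : ℂ) = z := Complex.ext (by simp) (by simp [hzero])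
    set x : ℝ := z.re with hx
    rw [← hzre] at hz ⊢
    rw [hA.extMap_ofReal hne hz, norm_real, Real.norm_eq_abs]
    have hxR : |x| ≤ R := by
      have : ‖((x : ℝ) : ℂ)‖ ≤ R := by rwa [hzre]
      rwa [norm_real, Real.norm_eq_abs] at this
    refine le_trans ?_ (le_max_right _ _)
    rcases (hA.ofReal_mem_plusDomain_iff hne).1 hz with hlt | hgt
    · have h1 : hA.realExt hne (-R - 1) ≤ hA.realExt hne x := by
        refine (hA.strictMonoOn_realExt_Iio hne).monotoneOn ?_ hlt ?_
        · show -R - 1 < leftPt A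
          linarith [abs_nonneg x, hA.leftPt_pos hne]
        · linarith [neg_abs_le x]
      have h2 := hA.realExt_lt_leftVal hne hlt
      rw [hM₂]
      have := abs_nonneg (hA.rightVal hne)
      have := abs_nonneg (hA.realExt hne (R + 1))
      have := abs_nonneg (hA.leftVal hne)
      have := abs_nonneg (hA.realExt hne (-R - 1))
      rw [abs_le]
      constructor
      · linarith [neg_abs_le (hA.realExt hne (-R - 1))]
      · linarith [le_abs_self (hA.leftVal hne)]
    · have h1 : hA.realExt hne x ≤ hA.realExt hne (R + 1) := by
        refine (hA.strictMonoOn_realExt_Ioi hne).monotoneOn hgt ?_ ?_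
        · show rightPt A < R + 1
          linarith [le_abs_self x]
        · linarith [le_abs_self x]
      have h2 := hA.rightVal_lt_realExt hne hgt
      rw [hM₂]
      have := abs_nonneg (hA.leftVal hne)
      have := abs_nonneg (hA.realExt hne (-R - 1))
      have := abs_nonneg (hA.rightVal hne)
      have := abs_nonneg (hA.realExt hne (R + 1))
      rw [abs_le]
      constructor
      · linarith [neg_abs_le (hA.rightVal hne)]
      · linarith [le_abs_self (hA.realExt hne (R + 1))]
  · exact (hup ⟨hpos, (hA.mem_plusDomain_iff_of_im_pos hpos).1 hz⟩ hzR).le.trans (le_max_left _ _)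

/-- `A ∩ ℍ` is nonempty for a nonempty hull (`A = cl(A ∩ ℍ)`). [folklore] -/
theorem IsPlusHull.inter_upperHalfPlaneSet_nonempty : (A ∩ upperHalfPlaneSet).Nonempty := by
  by_contra h
  rw [not_nonempty_iff_eq_empty] at h
  have := hA.1.isBoundedHull.closure_inter_eq
  rw [h, closure_empty] at this
  exact hne.ne_empty this.symm

/-- **`a < b`: the segment `[Φ_A(x₀), Φ_A(x₁)]` is nondegenerate.** If `a = b`, the inverse
`E_A⁻¹` is holomorphic and injective on `ℂ ∖ {a}` and bounded near `a` (as `‖E_A(z)‖ ≥ ‖z‖/2` far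
out), so extends to an entire function (Riemann's removable singularity theorem); `E_A⁻¹(w) - w`
is bounded (`E_A(z) - z → L`), hence constant (Liouville), so `Ω_A = E_A⁻¹(ℂ ∖ {a})` misses only
one point — but `K_A` contains `x₀ ∈ ℝ` and a point of `A ∩ ℍ`. [folklore] -/
theorem IsPlusHull.leftVal_lt_rightVal : hA.leftVal hne < hA.rightVal hne := by
  by_contra hnot
  have hab : hA.leftVal hne = hA.rightVal hne := le_antisymm (hA.leftVal_le_rightVal hne) (not_lt.1 hnot)
  -- `[a, b] = {a}`
  have hseg : hA.valSeg hne = {((hA.leftVal hne : ℝ) : ℂ)} := by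
    ext w
    rw [hA.mem_valSeg_iff hne, mem_singleton_iff, ← hab]
    constructor
    · rintro ⟨him, h1, h2⟩
      exact Complex.ext (by simp; linarith) (by simpa using him)
    · rintro rfl
      simp
  have hGd : DifferentiableOn ℂ (hA.invExt hne) {((hA.leftVal hne : ℝ) : ℂ)}ᶜ := by
    rw [← hseg]
    exact hA.differentiableOn_invExt hne
  -- `E_A⁻¹` is bounded near `a`
  obtain ⟨R₀, hR₀, hfar⟩ := hA.exists_norm_le_norm_extMap hne
  have hGbd : ∀ w : ℂ, w ≠ hA.leftVal hne → ‖w‖ ≤ ‖((hA.leftVal hne : ℝ) : ℂ)‖ + 1 →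
      ‖hA.invExt hne w‖ ≤ max R₀ (2 * (‖((hA.leftVal hne : ℝ) : ℂ)‖ + 1)) := by
    intro w hw hwn
    have hw' : w ∉ hA.valSeg hne := by rw [hseg]; exact hw
    by_contra hlt
    push Not at hlt
    have h1 : R₀ ≤ ‖hA.invExt hne w‖ := (le_max_left _ _).trans hlt.le
    have h2 := hfar (hA.invExt hne w) h1
    rw [hA.extMap_invExt hne hw'] at h2
    have h3 : 2 * (‖((hA.leftVal hne : ℝ) : ℂ)‖ + 1) < ‖hA.invExt hne w‖ := (le_max_right _ _).trans_lt hlt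
    linarith
  -- Riemann's removable singularity theorem on `ball a 1`
  set G' : ℂ → ℂ := Function.update (hA.invExt hne) (hA.leftVal hne)
    (limUnder (𝓝[≠] ((hA.leftVal hne : ℝ) : ℂ)) (hA.invExt hne)) with hG'
  have hG'_ball : DifferentiableOn ℂ G' (ball ((hA.leftVal hne : ℝ) : ℂ) 1) := by
    refine Complex.differentiableOn_update_limUnder_of_bddAbove (isOpen_ball.mem_nhds (mem_ball_self one_pos))
      (hGd.mono fun w hw ↦ hw.2) ⟨max R₀ (2 * (‖((hA.leftVal hne : ℝ) : ℂ)‖ + 1)), ?_⟩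
    rintro _ ⟨w, ⟨hwb, hwa⟩, rfl⟩
    refine hGbd w hwa ?_
    rw [mem_ball, dist_eq_norm] at hwb
    calc ‖w‖ = ‖(w - hA.leftVal hne) + hA.leftVal hne‖ := by ring_nf
      _ ≤ ‖w - hA.leftVal hne‖ + ‖((hA.leftVal hne : ℝ) : ℂ)‖ := norm_add_le _ _
      _ ≤ ‖((hA.leftVal hne : ℝ) : ℂ)‖ + 1 := by linarith
  have hG'_eq : ∀ w : ℂ, w ≠ hA.leftVal hne → G' w = hA.invExt hne w := fun w hw ↦ Function.update_of_ne hw _ _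
  have hG'd : Differentiable ℂ G' := by
    intro w
    by_cases hw : w ∈ ball ((hA.leftVal hne : ℝ) : ℂ) 1
    · exact (hG'_ball w hw).differentiableAt (isOpen_ball.mem_nhds hw)
    · have hwa : w ≠ hA.leftVal hne := fun h ↦ hw (h ▸ mem_ball_self one_pos)
      have hGw : DifferentiableAt ℂ (hA.invExt hne) w :=
        (hGd w hwa).differentiableAt (isOpen_compl_singleton.mem_nhds hwa)
      refine hGw.congr_of_eventuallyEq ?_
      filter_upwards [isOpen_compl_singleton.mem_nhds hwa] with w' hw'
      exact hG'_eq w' hw'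
  -- `G' w - w` is bounded
  obtain ⟨L, hL⟩ := hA.exists_tendsto_extMap_sub hne
  have hev : ∀ᶠ z in cocompact ℂ, dist (hA.extMap hne z - z) L < 1 := hL (ball_mem_nhds _ one_pos)
  rw [← cobounded_eq_cocompact, Filter.hasBasis_cobounded_norm.eventually_iff] at hev
  obtain ⟨R₆, -, hR₆⟩ := hev
  obtain ⟨M₆, hM₆⟩ := hA.exists_norm_extMap_le hne R₆
  set R₅ : ℝ := max (M₆ + 1) (‖((hA.leftVal hne : ℝ) : ℂ)‖ + 1) with hR₅
  have hcont : ContinuousOn (fun w ↦ G' w - w) (closedBall (0 : ℂ) R₅) :=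
    (hG'd.continuous.sub continuous_id).continuousOn
  obtain ⟨C₁, hC₁⟩ := (isCompact_closedBall (0 : ℂ) R₅).exists_bound_of_continuousOn hcont
  have hbound : ∀ w : ℂ, ‖G' w - w‖ ≤ max C₁ (‖(L : ℂ)‖ + 1) := by
    intro w
    by_cases hw : ‖w‖ ≤ R₅
    · exact (hC₁ w (mem_closedBall_zero_iff.2 hw)).trans (le_max_left _ _)
    · push Not at hw
      have hwa : w ≠ hA.leftVal hne := by
        intro h
        rw [h] at hw
        linarith [le_max_right (M₆ + 1) (‖((hA.leftVal hne : ℝ) : ℂ)‖ + 1)]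
      have hw' : w ∉ hA.valSeg hne := by rw [hseg]; exact hwa
      rw [hG'_eq w hwa]
      have hzΩ : hA.invExt hne w ∈ plusDomain A := hA.invExt_mem hne hw'
      have hEz : hA.extMap hne (hA.invExt hne w) = w := hA.extMap_invExt hne hw'
      have hz6 : R₆ ≤ ‖hA.invExt hne w‖ := by
        by_contra hlt
        push Not at hlt
        have := hM₆ _ hzΩ hlt.le
        rw [hEz] at this
        linarith [le_max_left (M₆ + 1) (‖((hA.leftVal hne : ℝ) : ℂ)‖ + 1)]
      have h7 := hR₆ hz6
      rw [hEz, dist_eq_norm] at h7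
      refine le_max_of_le_right ?_
      calc ‖hA.invExt hne w - w‖ = ‖w - hA.invExt hne w - L + L‖ := by
            rw [← norm_neg (hA.invExt hne w - w)]; ring_nf
        _ ≤ ‖w - hA.invExt hne w - L‖ + ‖(L : ℂ)‖ := norm_add_le _ _
        _ ≤ ‖(L : ℂ)‖ + 1 := by linarith
  -- Liouville
  have hF : Differentiable ℂ (fun w ↦ G' w - w) := hG'd.sub differentiable_id
  have hFb : IsBounded (range fun w ↦ G' w - w) :=
    isBounded_iff_forall_norm_le.2 ⟨_, by rintro _ ⟨w, rfl⟩; exact hbound w⟩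
  have hconst := hF.apply_eq_apply_of_bounded hFb
  set c₀ : ℂ := G' ((hA.leftVal hne : ℂ) + 1) - ((hA.leftVal hne : ℂ) + 1) with hc₀
  have hGform : ∀ w : ℂ, w ≠ hA.leftVal hne → hA.invExt hne w = w + c₀ := by
    intro w hw
    have := hconst w ((hA.leftVal hne : ℂ) + 1)
    rw [hG'_eq w hw] at this
    rw [hc₀, ← this]
    ring
  -- every point off `a + c₀` lies in `Ω_A`
  have hΩbig : ∀ z : ℂ, z ≠ (hA.leftVal hne : ℂ) + c₀ → z ∈ plusDomain A := by
    intro z hz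
    have hw : z - c₀ ≠ hA.leftVal hne := fun h ↦ hz (by rw [← h]; ring)
    have hw' : z - c₀ ∉ hA.valSeg hne := by rw [hseg]; exact hw
    have := hA.invExt_mem hne hw'
    rwa [hGform _ hw, sub_add_cancel] at this
  -- but `x₀` and a point of `A ∩ ℍ` are two distinct points off `Ω_A`
  have hx0K : ((leftPt A : ℝ) : ℂ) ∉ plusDomain A := fun h ↦ h (Or.inr (ofReal_mem_realSeg.2 left_mem_uIcc))
  obtain ⟨z₁, hz₁A, hz₁H⟩ := hA.inter_upperHalfPlaneSet_nonempty hne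
  have hz₁K : z₁ ∉ plusDomain A := fun h ↦ ((hA.mem_plusDomain_iff_of_im_pos hz₁H).1 h) hz₁A
  have e1 : ((leftPt A : ℝ) : ℂ) = hA.leftVal hne + c₀ := by
    by_contra h
    exact hx0K (hΩbig _ h)
  have e2 : z₁ = hA.leftVal hne + c₀ := by
    by_contra h
    exact hz₁K (hΩbig _ h)
  have him : z₁.im = 0 := by
    rw [e2, ← e1]
    simp
  have : (0 : ℝ) < z₁.im := hz₁H
  rw [him] at this
  exact lt_irrefl _ this

/-- **Boundary behaviour of `E_A` at `K_A`**: as `z ∈ Ω_A` approaches a point of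
`K_A = A ∪ Ā ∪ [x₀, x₁]`, `E_A(z)` approaches the segment `[a, b]` (a homeomorphism
`Ω_A → ℂ ∖ [a, b]` is proper: the preimage `E_A⁻¹(C)` of the compact set
`C = {dist(·, [a,b]) ≥ ε} ∩ {‖·‖ ≤ M}` is a compact subset of `Ω_A`, at positive distance from
`K_A`; `M` bounds `E_A` near `z₀`). This is the content of "`E_δ` is the closure of
`A ∪ Φ_A⁻¹(D_δ)`" being a neighbourhood of `A'` in `ℍ̄` ([LSW] p. 13). [cite: LawlerSchrammWerner2003Restriction, proof of Lemma 3.5 (p. 13, E_δ)] -/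
theorem IsPlusHull.exists_infDist_extMap_lt {z₀ : ℂ} (hz₀ : z₀ ∈ plusCompact A) {ε : ℝ} (hε : 0 < ε) :
    ∃ r > 0, ∀ z ∈ plusDomain A, dist z z₀ < r → infDist (hA.extMap hne z) (hA.valSeg hne) < ε := by
  obtain ⟨M, hM⟩ := hA.exists_norm_extMap_le hne (‖z₀‖ + 1)
  set C : Set ℂ := {w | ε ≤ infDist w (hA.valSeg hne)} ∩ closedBall 0 M with hC
  have hCc : IsCompact C :=
    (isCompact_closedBall (0 : ℂ) M).inter_left (isClosed_le continuous_const (continuous_infDist_pt _))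
  have hCsub : C ⊆ (hA.valSeg hne)ᶜ := fun w hw hwS ↦ by
    have := infDist_zero_of_mem hwS
    have h1 : ε ≤ infDist w (hA.valSeg hne) := hw.1
    linarith
  have hGC : IsCompact (hA.invExt hne '' C) := hCc.image_of_continuousOn ((hA.continuousOn_invExt hne).mono hCsub)
  have hz₀GC : z₀ ∉ hA.invExt hne '' C := by
    rintro ⟨w, hw, hwz⟩
    have := hA.invExt_mem hne (hCsub hw)
    rw [hwz] at this
    exact this hz₀
  obtain ⟨r, hr, hrball⟩ := Metric.isOpen_iff.1 hGC.isClosed.isOpen_compl z₀ hz₀GC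
  refine ⟨min r 1, lt_min hr one_pos, fun z hz hzr ↦ ?_⟩
  by_contra hge
  push Not at hge
  have hzn : ‖z‖ ≤ ‖z₀‖ + 1 := by
    have h1 : dist z z₀ < 1 := lt_of_lt_of_le hzr (min_le_right _ _)
    rw [dist_eq_norm] at h1
    calc ‖z‖ = ‖(z - z₀) + z₀‖ := by ring_nf
      _ ≤ ‖z - z₀‖ + ‖z₀‖ := norm_add_le _ _
      _ ≤ ‖z₀‖ + 1 := by linarith
  have hEC : hA.extMap hne z ∈ C := ⟨hge, mem_closedBall_zero_iff.2 (hM z hz hzn)⟩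
  have hzG : z ∈ hA.invExt hne '' C := ⟨hA.extMap hne z, hEC, hA.invExt_extMap hne hz⟩
  exact hrball (mem_ball.2 (lt_of_lt_of_le hzr (min_le_left _ _))) hzG

/-- **Boundary behaviour at the real filling, from `ℍ`**: as `z ∈ ℍ ∖ A` approaches a point of
`A' = A ∪ [x₀, x₁]`, `Φ_A(z)` approaches `[a, b]`. [cite: LawlerSchrammWerner2003Restriction, proof of Lemma 3.5 (p. 13, E_δ)] -/
theorem IsPlusHull.exists_infDist_baseMap_lt {z₀ : ℂ} (hz₀ : z₀ ∈ realFill A) {ε : ℝ} (hε : 0 < ε) :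
    ∃ r > 0, ∀ z ∈ upperHalfPlaneSet \ A, dist z z₀ < r → infDist (hA.baseMap hne z) (hA.valSeg hne) < ε := by
  obtain ⟨r, hr, h⟩ := hA.exists_infDist_extMap_lt hne (hA.realFill_subset_plusCompact hne hz₀) hε
  refine ⟨r, hr, fun z hz hzr ↦ ?_⟩
  rw [← hA.extMap_of_mem_diff hne hz]
  exact h z (hA.diff_subset_plusDomain hz) hzr

end Boundary

end Literature.Probability.RandomPlanarGeometry
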